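import Mathlib
import HarnessLib

/-!
# Arnold's quadratic form for a Beltrami host: exact conservation and sector-wise Lyapunov stability

HONEST FRAMING (cell `ns-blowup`, seat `ns-blowup-circuit` g2, human ruling D-0035): this cell ATTEMPTS
the negative direction of the Clay problem; nothing in this file is a claim about Navier–Stokes.
WHAT THIS IS NOT: not a statement about the Navier–Stokes or Euler PDE; it is the exact ALGEBRAIC core
of memo `run/shared/lean/pub/ns-blowup/CIRCUIT-OBSTRUCTIONS.md` §H.5(a) / §I.3 ("the pumped energy must
appear in the helicity sector opposite to a Beltrami host's"), stated for an ABSTRACT energy–helicity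
pair so that it applies verbatim to Euler, to every Galerkin truncation, and to every Fourier/helical
restriction `P_S` that commutes with `curl` (all of which conserve the two quadratic invariants used).

Setting: a real inner-product space `E` (velocity fields, `‖u‖² = 2·energy`), a symmetric bilinear
"helicity form" `h` (`h u v = ∫ u · curl v`, symmetric on divergence-free fields), and a BELTRAMI HOST
`U`: `h U v = λ ⟪U, v⟫` for all `v` (weak form of `curl U = λ U`). Arnold's form is
`Q_λ(v) := h(v,v) − λ‖v‖²` (written out inline below, no new definition); in helical Fourier variables
`Q_λ(v) = Σ_{q,σ} (σ|q| − λ)|v̂_{q,σ}|²`.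

## What is typed
* `arnoldForm_host` — `Q_λ(U) = 0`.
* `arnoldForm_sub_host` — THE IDENTITY: `Q_λ(u − U) = Q_λ(u)` for every state `u` (the cross terms
  `2λ⟪U,v⟫ − 2λ⟪U,v⟫` cancel exactly; no smallness, no linearisation).
* `arnoldForm_perturbation_conserved` — along ANY trajectory `u : ℝ → E` on which `h(u,u)` and `‖u‖`
  are conserved (Euler: helicity and energy), `Q_λ(u t − U)` is constant.
* `perturbation_norm_sq_le` — if the perturbation lies at time `t` in a sector where `h(v,v) ≥ μ‖v‖²`
  with `μ > λ` (homochiral with the host and of larger wavenumber modulus), then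
  `(μ − λ)‖u t − U‖² ≤ Q_λ(u 0 − U)`; with `h(v₀,v₀) ≤ M‖v₀‖²` initially,
  `‖u t − U‖² ≤ (M − λ)/(μ − λ) · ‖u 0 − U‖²` — uniform in time: NONLINEAR Lyapunov stability, zero
  exponential growth in that sector (`perturbation_norm_sq_le_ratio`); the mirror sector `h ≤ μ'‖·‖²`,
  `μ' < λ` likewise (`perturbation_norm_sq_le_of_sub_sector`).
* `weighted_sum_sq_ge` / `weighted_sum_sq_le` — the finite helical-coefficient instance of the sector
  hypothesis: `Σ w_i x_i² ≥ μ Σ x_i²` when every weight `w_i = σ_i|q_i| ≥ μ` (the sign bookkeeping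
  `|q| − |p| > 0` per leg is `TriadGateDictionary.beltrami_weight_pos`, already in the tree).
Honest limits: the hypotheses "energy and helicity are conserved along `u`" and "the perturbation stays
in the sector" are INPUTS (true for Euler / commuting restrictions, and for helical decimations that
keep only the sector, respectively); nothing here asserts them for any PDE.
-/

namespace Summit.NavierStokesRegularity.FluidComputer.ArnoldBeltramiForm

open scoped RealInnerProductSpace

variable {E : Type*} [NormedAddCommGroup E] [InnerProductSpace ℝ E]

/-- The host itself has `Q_λ(U) = h(U,U) − λ‖U‖² = λ‖U‖² − λ‖U‖² = 0`. -/
theorem arnoldForm_host (h : E →ₗ[ℝ] E →ₗ[ℝ] ℝ) {lam : ℝ} {U : E}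
    (hU : ∀ v, h U v = lam * ⟪U, v⟫) : h U U - lam * ‖U‖ ^ 2 = 0 := by
  rw [hU U, real_inner_self_eq_norm_sq]
  ring

/-- THE IDENTITY (memo H.5(a)): for a symmetric helicity form and a Beltrami host `U`
(`h U v = λ⟪U,v⟫` for all `v`), the Arnold form of the perturbation equals the Arnold form of the
full state: `Q_λ(u − U) = Q_λ(u)`. Expanding, the cross terms are `−2 h(U, u) + 2λ⟪U, u⟫ = 0`. -/
theorem arnoldForm_sub_host (h : E →ₗ[ℝ] E →ₗ[ℝ] ℝ) (hsymm : ∀ u v, h u v = h v u)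
    {lam : ℝ} {U : E} (hU : ∀ v, h U v = lam * ⟪U, v⟫) (u : E) :
    h (u - U) (u - U) - lam * ‖u - U‖ ^ 2 = h u u - lam * ‖u‖ ^ 2 := by
  have h1 : h (u - U) (u - U) = h u u - 2 * (lam * ⟪U, u⟫) + lam * ‖U‖ ^ 2 := by
    simp only [map_sub, LinearMap.sub_apply]
    rw [hsymm u U, hU u, hU U, real_inner_self_eq_norm_sq]
    ring
  have h2 : ‖u - U‖ ^ 2 = ‖u‖ ^ 2 - 2 * ⟪u, U⟫ + ‖U‖ ^ 2 := norm_sub_sq_real u U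
  rw [h1, h2, real_inner_comm U u]
  ring

/-- `Q_λ(u) = H(u) − λ·‖u‖²` is a fixed combination of the two quadratic invariants, so it is conserved
whenever they are; by `arnoldForm_sub_host` the same holds for the PERTURBATION `u t − U`:
exact conservation of `Q_λ(u(t) − U)` along any energy- and helicity-conserving trajectory. -/
theorem arnoldForm_perturbation_conserved (h : E →ₗ[ℝ] E →ₗ[ℝ] ℝ) (hsymm : ∀ u v, h u v = h v u)
    {lam : ℝ} {U : E} (hU : ∀ v, h U v = lam * ⟪U, v⟫) (u : ℝ → E)
    (hH : ∀ t, h (u t) (u t) = h (u 0) (u 0)) (hE : ∀ t, ‖u t‖ = ‖u 0‖) (t : ℝ) :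
    h (u t - U) (u t - U) - lam * ‖u t - U‖ ^ 2 = h (u 0 - U) (u 0 - U) - lam * ‖u 0 - U‖ ^ 2 := by
  rw [arnoldForm_sub_host h hsymm hU, arnoldForm_sub_host h hsymm hU, hH t, hE t]

/-- LYAPUNOV BOUND IN THE SUPER-SECTOR. If at time `t` the perturbation `v = u t − U` satisfies
`μ‖v‖² ≤ h(v,v)` (e.g. helical support homochiral with the host, every modulus `≥ μ`), then
`(μ − λ)‖u t − U‖² ≤ Q_λ(u 0 − U)`; informative when `μ > λ`. -/
theorem perturbation_norm_sq_le (h : E →ₗ[ℝ] E →ₗ[ℝ] ℝ) (hsymm : ∀ u v, h u v = h v u)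
    {lam : ℝ} {U : E} (hU : ∀ v, h U v = lam * ⟪U, v⟫) (u : ℝ → E)
    (hH : ∀ t, h (u t) (u t) = h (u 0) (u 0)) (hE : ∀ t, ‖u t‖ = ‖u 0‖) {mu : ℝ} {t : ℝ}
    (hsector : mu * ‖u t - U‖ ^ 2 ≤ h (u t - U) (u t - U)) :
    (mu - lam) * ‖u t - U‖ ^ 2 ≤ h (u 0 - U) (u 0 - U) - lam * ‖u 0 - U‖ ^ 2 := by
  rw [← arnoldForm_perturbation_conserved h hsymm hU u hH hE t]
  nlinarith [hsector]

/-- Uniform-in-time form: with `h(v₀,v₀) ≤ M‖v₀‖²` initially and the super-sector bound `μ > λ` at time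
`t`, `‖u t − U‖² ≤ (M − λ)/(μ − λ) · ‖u 0 − U‖²` — zero exponential growth (Arnold's method for a
Beltrami host, mode by mode). -/
theorem perturbation_norm_sq_le_ratio (h : E →ₗ[ℝ] E →ₗ[ℝ] ℝ) (hsymm : ∀ u v, h u v = h v u)
    {lam : ℝ} {U : E} (hU : ∀ v, h U v = lam * ⟪U, v⟫) (u : ℝ → E)
    (hH : ∀ t, h (u t) (u t) = h (u 0) (u 0)) (hE : ∀ t, ‖u t‖ = ‖u 0‖) {mu M : ℝ}
    (hmu : lam < mu) {t : ℝ}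
    (hsector : mu * ‖u t - U‖ ^ 2 ≤ h (u t - U) (u t - U))
    (hinit : h (u 0 - U) (u 0 - U) ≤ M * ‖u 0 - U‖ ^ 2) :
    ‖u t - U‖ ^ 2 ≤ (M - lam) / (mu - lam) * ‖u 0 - U‖ ^ 2 := by
  have hpos : 0 < mu - lam := sub_pos.mpr hmu
  have key := perturbation_norm_sq_le h hsymm hU u hH hE hsector
  rw [div_mul_eq_mul_div, le_div_iff₀ hpos]
  nlinarith [key, hinit]

/-- THE MIRROR (SUB-)SECTOR: if instead `h(v,v) ≤ μ'‖v‖²` at time `t` with `μ' < λ` (e.g. helicity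
opposite to the host's, where `σ|q| − λ < 0` for every mode), then `(λ − μ')‖u t − U‖² ≤ −Q_λ(u 0 − U)`. -/
theorem perturbation_norm_sq_le_of_sub_sector (h : E →ₗ[ℝ] E →ₗ[ℝ] ℝ)
    (hsymm : ∀ u v, h u v = h v u) {lam : ℝ} {U : E} (hU : ∀ v, h U v = lam * ⟪U, v⟫)
    (u : ℝ → E) (hH : ∀ t, h (u t) (u t) = h (u 0) (u 0)) (hE : ∀ t, ‖u t‖ = ‖u 0‖)
    {mu' : ℝ} {t : ℝ} (hsector : h (u t - U) (u t - U) ≤ mu' * ‖u t - U‖ ^ 2) :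
    (lam - mu') * ‖u t - U‖ ^ 2 ≤ -(h (u 0 - U) (u 0 - U) - lam * ‖u 0 - U‖ ^ 2) := by
  rw [← arnoldForm_perturbation_conserved h hsymm hU u hH hE t]
  nlinarith [hsector]

/-! ## The finite helical-coefficient instance of the sector hypothesis
In helical Fourier variables `h(v,v) = Σ_i w_i x_i²` with weights `w_i = σ_i |q_i|` and
`‖v‖² = Σ_i x_i²`; a perturbation supported where every weight is `≥ μ` (resp. `≤ μ'`) satisfies the
super- (resp. sub-) sector bound. -/

/-- If every weight is at least `μ`, then `μ · Σ x_i² ≤ Σ w_i x_i²`. -/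
theorem weighted_sum_sq_ge {ι : Type*} (s : Finset ι) (w x : ι → ℝ) {mu : ℝ}
    (hw : ∀ i ∈ s, mu ≤ w i) :
    mu * ∑ i ∈ s, x i ^ 2 ≤ ∑ i ∈ s, w i * x i ^ 2 := by
  rw [Finset.mul_sum]
  exact Finset.sum_le_sum fun i hi => mul_le_mul_of_nonneg_right (hw i hi) (sq_nonneg _)

/-- If every weight is at most `μ'`, then `Σ w_i x_i² ≤ μ' · Σ x_i²`. -/
theorem weighted_sum_sq_le {ι : Type*} (s : Finset ι) (w x : ι → ℝ) {mu' : ℝ}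
    (hw : ∀ i ∈ s, w i ≤ mu') :
    ∑ i ∈ s, w i * x i ^ 2 ≤ mu' * ∑ i ∈ s, x i ^ 2 := by
  rw [Finset.mul_sum]
  exact Finset.sum_le_sum fun i hi => mul_le_mul_of_nonneg_right (hw i hi) (sq_nonneg _)


/-! ## The LINEARISED dynamics about a Beltrami host (appended 2026-08-25, circuit g2; memo §K)

For NS linearised about a forced Beltrami host `U` (`curl U = λU`, force `νλ²U`),
`∂ₜv = P[U × (curl v − λ v)] + νΔv` (vector identity `−(U·∇)v − (v·∇)U = −∇(U·v) + U × (curl v − λv)`;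
this is the operator of the cell's P-LADDER-3 engines). Abstractly: a symmetric operator `C` ("curl",
`h(u,v) = ⟪C u, v⟫`), an operator `J` with `⟪a, J a⟫ = 0` for all `a` ("`a ↦ P(U × a)`", pointwise
`a·(U × a) = 0`), and `L = J ∘ (C − λ) − ν C ∘ C` (`Δ = −curl curl` on divergence-free fields). Then the
Arnold pairing of `v` with `L v` is `⟪(C − λ)v, L v⟫ = −ν Q_λ(C v)`: the inviscid part conserves `Q_λ`
EXACTLY (not only for Euler but for the linearisation about the host), and for a real eigenpair
`L w = μ w` the growth rate obeys `μ · Q_λ(w) = −ν · Q_λ(C w)` — an inviscid (`ν = 0`) non-neutral mode is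
Arnold-null, and a viscous growing mode has Arnold forms of opposite signs at the energy and enstrophy
levels, with `μ = −ν Q_λ(Cw)/Q_λ(w)`. (Complex eigenpairs: the same with Hermitian forms; not typed here.) -/

/-- THE LINEARISED ARNOLD PAIRING: with `C` symmetric, `⟪a, J a⟫ = 0` for all `a`, and
`L v = J (C v − λ v) − ν C (C v)`, one has `⟪C v − λ v, L v⟫ = −ν (⟪C (C v), C v⟫ − λ ‖C v‖²)`,
i.e. `½ d/dt Q_λ(v) = −ν Q_λ(C v)` along `v' = L v`. [folklore] -/
theorem linearised_arnold_pairing (C J : E →ₗ[ℝ] E) (hC : ∀ u v, ⟪C u, v⟫ = ⟪u, C v⟫)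
    (hJ : ∀ a, ⟪a, J a⟫ = 0) (lam nu : ℝ) (v : E) :
    ⟪C v - lam • v, J (C v - lam • v) - nu • C (C v)⟫ =
      -nu * (⟪C (C v), C v⟫ - lam * ‖C v‖ ^ 2) := by
  rw [inner_sub_right, hJ, inner_smul_right, inner_sub_left, inner_smul_left, ← hC (C v) (C v),
    ← hC v (C v), real_inner_self_eq_norm_sq]
  simp only [conj_trivial]
  ring

/-- At `ν = 0` the linearised dynamics conserves the Arnold form exactly:
`⟪C v − λ v, J (C v − λ v)⟫ = 0`. [folklore] -/
theorem linearised_arnold_pairing_inviscid (C J : E →ₗ[ℝ] E) (hJ : ∀ a, ⟪a, J a⟫ = 0)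
    (lam : ℝ) (v : E) : ⟪C v - lam • v, J (C v - lam • v)⟫ = 0 :=
  hJ _

/-- THE EIGENMODE LAW (real eigenpairs): if `L w = μ w` with `L = J (C − λ) − ν C²` as above, then
`μ · Q_λ(w) = −ν · Q_λ(C w)`, where `Q_λ(x) = ⟪C x, x⟫ − λ‖x‖²`. [folklore] -/
theorem eigenmode_arnold_law (C J : E →ₗ[ℝ] E) (hC : ∀ u v, ⟪C u, v⟫ = ⟪u, C v⟫)
    (hJ : ∀ a, ⟪a, J a⟫ = 0) {lam nu mu : ℝ} {w : E}
    (hw : J (C w - lam • w) - nu • C (C w) = mu • w) :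
    mu * (⟪C w, w⟫ - lam * ‖w‖ ^ 2) = -nu * (⟪C (C w), C w⟫ - lam * ‖C w‖ ^ 2) := by
  have h := linearised_arnold_pairing C J hC hJ lam nu w
  rw [hw, inner_smul_right, inner_sub_left, inner_smul_left, real_inner_self_eq_norm_sq] at h
  simp only [conj_trivial] at h
  linarith [h]

/-- Consequences read in the memo: (i) `ν = 0` and `μ ≠ 0` force `Q_λ(w) = 0` (inviscid non-neutral modes
of a Beltrami host are Arnold-null); (ii) for `ν > 0`, `μ > 0` and `Q_λ(w) < 0` force `Q_λ(Cw) > 0`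
(a growing mode carries Arnold weight of opposite signs at the energy and enstrophy levels). [folklore] -/
theorem eigenmode_arnold_null_of_inviscid (C J : E →ₗ[ℝ] E) (hC : ∀ u v, ⟪C u, v⟫ = ⟪u, C v⟫)
    (hJ : ∀ a, ⟪a, J a⟫ = 0) {lam mu : ℝ} {w : E} (hmu : mu ≠ 0)
    (hw : J (C w - lam • w) - (0 : ℝ) • C (C w) = mu • w) :
    ⟪C w, w⟫ - lam * ‖w‖ ^ 2 = 0 := by
  have h := eigenmode_arnold_law C J hC hJ hw
  simp only [neg_zero, zero_mul] at h
  rcases mul_eq_zero.mp h with h | h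
  · exact absurd h hmu
  · exact h

/-- (ii) of the previous docstring. [folklore] -/
theorem eigenmode_enstrophy_form_pos (C J : E →ₗ[ℝ] E) (hC : ∀ u v, ⟪C u, v⟫ = ⟪u, C v⟫)
    (hJ : ∀ a, ⟪a, J a⟫ = 0) {lam nu mu : ℝ} {w : E} (hnu : 0 < nu) (hmu : 0 < mu)
    (hw : J (C w - lam • w) - nu • C (C w) = mu • w) (hQ : ⟪C w, w⟫ - lam * ‖w‖ ^ 2 < 0) :
    0 < ⟪C (C w), C w⟫ - lam * ‖C w‖ ^ 2 := by
  have h := eigenmode_arnold_law C J hC hJ hw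
  have h1 : mu * (⟪C w, w⟫ - lam * ‖w‖ ^ 2) < 0 := mul_neg_of_pos_of_neg hmu hQ
  rw [h] at h1
  nlinarith [h1]


/-! ## Complex eigenpairs (appended 2026-08-25, circuit g2): the same law with Hermitian forms.
On a complex inner-product space (Mathlib's inner product is conjugate-linear in the FIRST slot),
with `C` self-adjoint, `Re ⟪a, J a⟫ = 0` for all `a`, and `L w = J(Cw − λw) − ν C(Cw) = μ w`:
`Re μ · Q_λ(w) = −ν · Q_λ(Cw)` and `Im μ · Q_λ(w) = Im ⟪(C − λ)w, J((C − λ)w)⟫`, where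
`Q_λ(x) = Re ⟪Cx, x⟫ − λ‖x‖²` (the Hopf branches of the P-LADDER-3 spectrum). -/

section Complex

variable {F : Type*} [NormedAddCommGroup F] [InnerProductSpace ℂ F]

open Complex ComplexConjugate in
/-- THE EIGENMODE LAW for complex eigenpairs (Hermitian Arnold forms). [folklore] -/
theorem eigenmode_arnold_law_complex (C J : F →ₗ[ℂ] F)
    (hC : ∀ u v : F, inner ℂ (C u) v = inner ℂ u (C v))
    (hJ : ∀ a : F, (inner ℂ a (J a)).re = 0) {lam nu : ℝ} {mu : ℂ} {w : F}
    (hw : J (C w - (lam : ℂ) • w) - (nu : ℂ) • C (C w) = mu • w) :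
    mu.re * ((inner ℂ (C w) w).re - lam * ‖w‖ ^ 2) =
      -nu * ((inner ℂ (C (C w)) (C w)).re - lam * ‖C w‖ ^ 2) := by
  -- pair the eigen-equation with `a = C w − λ w`
  set a : F := C w - (lam : ℂ) • w with ha
  have key : inner ℂ a (J a - (nu : ℂ) • C (C w)) = inner ℂ a (mu • w) := by rw [hw]
  rw [inner_sub_right, inner_smul_right, inner_smul_right] at key
  have h1 : inner ℂ a w = inner ℂ (C w) w - (lam : ℂ) * inner ℂ w w := by
    rw [ha, inner_sub_left, inner_smul_left, conj_ofReal]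
  have h2 : inner ℂ a (C (C w)) = inner ℂ (C (C w)) (C w) - (lam : ℂ) * inner ℂ (C w) (C w) := by
    rw [ha, inner_sub_left, inner_smul_left, conj_ofReal, ← hC (C w) (C w), ← hC w (C w)]
  rw [h1, h2] at key
  -- `⟪Cw, w⟫`, `⟪C(Cw), Cw⟫` are real by self-adjointness; `⟪x, x⟫ = ‖x‖²`
  have hz1 : conj (inner ℂ (C w) w) = inner ℂ (C w) w := by rw [inner_conj_symm, ← hC w w]
  have hz2 : conj (inner ℂ (C (C w)) (C w)) = inner ℂ (C (C w)) (C w) := by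
    rw [inner_conj_symm, ← hC (C w) (C w)]
  have hr1 : (inner ℂ (C w) w).im = 0 := conj_eq_iff_im.mp hz1
  have hr2 : (inner ℂ (C (C w)) (C w)).im = 0 := conj_eq_iff_im.mp hz2
  have n1 : (inner ℂ w w).re = ‖w‖ ^ 2 := by simpa using inner_self_eq_norm_sq (𝕜 := ℂ) w
  have n2 : (inner ℂ (C w) (C w)).re = ‖C w‖ ^ 2 := by
    simpa using inner_self_eq_norm_sq (𝕜 := ℂ) (C w)
  have m1 : (inner ℂ w w).im = 0 := by simpa using inner_self_im (𝕜 := ℂ) w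
  have m2 : (inner ℂ (C w) (C w)).im = 0 := by simpa using inner_self_im (𝕜 := ℂ) (C w)
  have hre := congrArg Complex.re key
  simp only [sub_re, sub_im, mul_re, mul_im, ofReal_re, ofReal_im, hr1, hr2, n1, n2, m1, m2,
    mul_zero, zero_mul, sub_zero, add_zero, hJ a] at hre
  linarith [hre]

end Complex

end Summit.NavierStokesRegularity.FluidComputer.ArnoldBeltramiForm
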